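import Summits.KontsevichZagierPeriods.KontsevichZagierPeriods.Theses.KinematicFormulas
import Summits.KontsevichZagierPeriods.KontsevichZagierPeriods.Theorems.AbelContractionAreasToArcs

/-!
# Crux `KinematicKernelR` (stmt-KontsevichZagierPeriods-10863, route KinematicFormulas, rank-0 target crux) — `Lines/birth.lean`

BIRTH SKELETON (BC3) of the route's GPC-strength target

  `KinematicKernelR` : the kernel conjecture of the ENLARGED calculus `KZ^kin` — every formal
  `ℤ`-combination of integral representations with value `0` lies in
  `R_kin := AddSubgroup.closure (domainAddRel ∪ integrandAddRel ∪ changeOfVariablesRel ∪ newtonLeibnizRel ∪ Kin)`,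
  `Kin` = the plane principal-kinematic (Blaschke) relators `[Inc(K,L)] − [ℝ_t × K] − [ℝ_t × L] −
  [LineHit K × LineHit L]` for NON-EMPTY compact convex `ℚ`-semialgebraic `K, L ⊂ ℝ²` (route header:
  "freshman calculus with Blaschke's formula as a rule"; modulo the engine `KinematicPlaneConvexR` it is
  equivalent to `Literature.NumberTheory.Transcendental.KZKernelConjecture`).

The skeleton cuts the target along the programme's common seam, the INPUT-DIMENSION FILTRATION
(1-period layer ⊂ one-dimensional pairs ⊂ all inputs), so that both open pieces are EXISTING, shared,
independently staffed ledger items and one proof of either serves every kernel-type target of the summit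
(same cut as `Cruxes/RealArcKernel/Lines/birth.lean`; cf. `Cruxes/OrientationKernel/Lines/birth.lean`):

* `stub_planarAreas` — the 1-PERIOD LAYER = item `PlanarAreas` (stmt-KontsevichZagierPeriods-4990) VERBATIM,
  the shared crux of routes LowDimension / HodgeLevel / AbelContraction (support in SymplecticScissors; live
  line `Cruxes/PlanarAreas/Lines/green-native-bands.lean`, standing disproof file
  `Cruxes/PlanarAreas/Disproof.lean`): two planar integrand-`1` representations of equal area are
  KZ-equivalent (curved planar Hilbert III over `ℚ̄` inside the rules; Huber–Wüstholz Thm 13.3 transferred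
  into real move chains). Conjecture-grade, size XL.
* `stub_reductionToDimensionOne` — the REDUCTION TO DIMENSION ONE = item `ReductionToDimensionOne`
  (stmt-KontsevichZagierPeriods-14403, crux of route AbelContraction) VERBATIM: every subgroup
  `R ≥ KZ.relations` containing `[r] − [r′]` for all equal-valued pairs of ONE-dimensional representations
  contains `ker KZ.eval`. Conjecture-grade (GPC-strength outside the 1-period layer, stated openly).
* `KinematicKernelR_of` — sorry-free composition concluding the crux BY NAME: `R_kin` is an admissible `R`
  — `KZ.relations ≤ R_kin` because the generator set of `KZ^kin` CONTAINS the four move sets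
  (`AddSubgroup.closure_mono Set.subset_union_left`; this is the only place the kinematic calculus enters,
  and it enters through its shape, not through the values of the Blaschke relators, whose soundness — the
  principal kinematic formula as a VALUE identity — is neither in the tree nor assumed); the LANDED transfer
  `AreasToArcs` (stmt-0117, `Summit.KontsevichZagierPeriods.AbelContraction.AreasToArcs.areasToArcs_proof`:
  rule (1b) `f = (f + |f|) − |f|`, rule (3) with primitive `t` onto two disjoint bands, rule (1a)) turns the
  planar layer into `[r] − [r′] ∈ KZ.relations ≤ R_kin` for every equal-valued one-dimensional pair; the
  reduction then puts `ker KZ.eval` inside `R_kin`, which is the crux unfolded.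

Honest strength bookkeeping (as for RealArcKernel): `stub_planarAreas ∧ stub_reductionToDimensionOne` is
equivalent to the kernel form of the summit (`KZKernelConjecture`; Literature/NumberTheory/Transcendental/KZKernelConjectureForms.lean, `kzKernelConjecture_iff_isRational`), hence
implies the target WITHOUT the engine — exactly the status the route header avows for `KinematicKernelR`
("modulo KinematicPlaneConvexR equivalent to KZKernelConjecture"; `KZKernelConjecture → KinematicKernelR`
unconditionally by the same `closure_mono`, grounder g19-23 / refuter g46-1 notes on the item). The
kinematic relators are load-bearing only in the OTHER direction, inside the route's deciding theorem
`closes (hE : KinematicPlaneConvexR) (hK : KinematicKernelR)`, where the engine folds `R_kin` back into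
`KZ.relations`. Neither stub alone is cheaply the crux or the summit (BC3 probes in the registrar's folder
`bc/probe_*.lean`, `stub → KinematicKernelR` and `stub → KontsevichZagierPeriods` by
`first | exact? | simpa | aesop` (+ `simpa [T]`, `unfold T; simpa`): all FAIL): `stub_planarAreas → crux`
needs the reduction (open), `stub_reductionToDimensionOne → crux` needs the equal-valued one-dimensional
pairs inside `R_kin`, i.e. the 1-period layer (open), and `→ KontsevichZagierPeriods` needs both plus the
two-representation/kernel glue.

Disproof used: none on record for THIS crux (`ledger crux ls stmt-KontsevichZagierPeriods-10863`: no
`Disproof.lean`, no dead lines). The stub `stub_planarAreas` inherits the standing obligations of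
`Cruxes/PlanarAreas/Disproof.lean` (any proof must use rule (2) and rule (3): `not_withoutRule2`,
`planarAreas_of_withoutRule3`/`not_additivityOnly`; no separating additive invariant:
`not_of_separating_invariant`) — obligations on ITS provers, not on this composition. Negatives index of the
summit (`ledger negatives`): one entry, KinematicPlaneConvex (stmt-5394, witness `L = ∅`) — the crux's
relator set carries `K.Nonempty ∧ L.Nonempty`, and neither stub mentions convex bodies.

References: M. Kontsevich, D. Zagier, *Periods* (2001), §1.2 Conjecture 1 [KontsevichZagier2001];
A. Huber, S. Müller-Stach, *Periods and Nori Motives* (2017), Ch. 13 [HuberMullerStach2017]; A. Huber,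
G. Wüstholz, *Transcendence and Linear Relations of 1-Periods* (2022), Thm 13.3 [HuberWustholz2022];
L. A. Santaló, *Integral Geometry and Geometric Probability* (2004), §I.7 [SantaloKac2004]; A. Bernig,
J. H. G. Fu, *Hermitian integral geometry*, Ann. of Math. 173 (2011) [BernigFu2011].
-/

set_option linter.dupNamespace false

noncomputable section

open Literature.NumberTheory.Transcendental

namespace Summit.KontsevichZagierPeriods.KontsevichZagierPeriods.Cruxes.KinematicKernelR.Birth

/-! ## Registered stubs -/

/-- **The 1-period layer** (`PlanarAreas`, item stmt-KontsevichZagierPeriods-4990, verbatim): two planar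
representations with integrand `1` on their domains (two `ℚ`-semialgebraic planar sets of finite area) and
the same area are KZ-equivalent — curved planar Hilbert III over `ℚ̄` inside the rules. By Green /
Newton–Leibniz along `y` these areas are exactly the real 1-periods, so this is Huber–Wüstholz's theorem
(all `ℚ̄`-linear relations among 1-periods are of motivic origin, Thm 13.3) TRANSFERRED into chains of real
semialgebraic moves. Why it might fail: one isogeny / correspondence / residue identity among real
1-periods with no real move chain refutes it (and the summit). Closes when stmt-4990 closes. [size XL]
[cite: HuberWustholz2022, Thm 13.3] [cite: KontsevichZagier2001, §1.2] -/
theorem stub_planarAreas :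
    ∀ (r r' : KZ.IntegralRep 2), (∀ p ∈ r.domain, r.integrand p = 1) →
      (∀ p ∈ r'.domain, r'.integrand p = 1) → r.value = r'.value → KZ.Equivalent r r' := by
  sorry

/-- **Reduction of the kernel to dimension one** (`ReductionToDimensionOne`, item
stmt-KontsevichZagierPeriods-14403, verbatim; GPC-strength, stated openly): every subgroup
`R ≥ KZ.relations` that contains `[r] − [r′]` for every equal-valued pair of one-dimensional
representations contains `ker KZ.eval` — every value-`0` formal combination is a sum of move instances
and of differences of equal-valued one-dimensional representations. It isolates the inputs of dimension
`≥ 2` (MZV simplices, `Γ`-products, quasi-period products, and here the kinematic incidence integrals of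
dimension `3`/`4`) on which no transcendence theory exists; to be peeled by further layers, never attacked
head-on. Why it might fail: false iff some value-`0` combination outside the 1-period layer is underivable
(route Neg's bets: Gauss-triplication pair, regularised MZV relations). Closes when stmt-14403 closes.
[size open-problem] [cite: KontsevichZagier2001, §1.2] -/
theorem stub_reductionToDimensionOne :
    ∀ R : AddSubgroup KZ.FormalRep, KZ.relations ≤ R →
      (∀ (r r' : KZ.IntegralRep 1), r.value = r'.value → KZ.of r - KZ.of r' ∈ R) →
      ∀ x : KZ.FormalRep, KZ.eval x = 0 → x ∈ R := by
  sorry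

/-! ## The stubs are existing items verbatim (kernel-checked identifications) -/

example : (∀ (r r' : KZ.IntegralRep 2), (∀ p ∈ r.domain, r.integrand p = 1) →
      (∀ p ∈ r'.domain, r'.integrand p = 1) → r.value = r'.value → KZ.Equivalent r r') ↔
    Summit.KontsevichZagierPeriods.KontsevichZagierPeriods.Theses.AbelContraction.PlanarAreas :=
  Iff.rfl

example : (∀ R : AddSubgroup KZ.FormalRep, KZ.relations ≤ R →
      (∀ (r r' : KZ.IntegralRep 1), r.value = r'.value → KZ.of r - KZ.of r' ∈ R) →
      ∀ x : KZ.FormalRep, KZ.eval x = 0 → x ∈ R) ↔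
    Summit.KontsevichZagierPeriods.KontsevichZagierPeriods.Theses.AbelContraction.ReductionToDimensionOne :=
  Iff.rfl

/-! ## Composition (no `sorry` below this line) -/

/-- **Composition, arrow form** `<stub₁-sig> → <stub₂-sig> → crux`, the crux UNFOLDED verbatim (so that
exactly one theorem of this file, `KinematicKernelR_of`, concludes the crux by name). Given `c` with
`KZ.eval c = 0`, apply the reduction to `R := R_kin`: (i) `KZ.relations ≤ R_kin` by monotonicity of
`AddSubgroup.closure` in the generator set (`KZ^kin` has the four move sets among its generators);
(ii) for an equal-valued one-dimensional pair, the landed transfer `areasToArcs_proof` fed with the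
planar layer gives `[r] − [r′] ∈ KZ.relations`, hence `∈ R_kin` by (i). Soundness of the moves and of
the Blaschke relators is not used. [cite: KontsevichZagier2001, §1.2] -/
theorem kinematicKernelR_of_stubs
    (hP : ∀ (r r' : KZ.IntegralRep 2), (∀ p ∈ r.domain, r.integrand p = 1) →
      (∀ p ∈ r'.domain, r'.integrand p = 1) → r.value = r'.value → KZ.Equivalent r r')
    (hRed : ∀ R : AddSubgroup KZ.FormalRep, KZ.relations ≤ R →
      (∀ (r r' : KZ.IntegralRep 1), r.value = r'.value → KZ.of r - KZ.of r' ∈ R) →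
      ∀ x : KZ.FormalRep, KZ.eval x = 0 → x ∈ R) :
    ∀ c : Literature.NumberTheory.Transcendental.KZ.FormalRep, Literature.NumberTheory.Transcendental.KZ.eval c = 0 → c ∈ AddSubgroup.closure (Literature.NumberTheory.Transcendental.KZ.domainAddRel ∪ Literature.NumberTheory.Transcendental.KZ.integrandAddRel ∪ Literature.NumberTheory.Transcendental.KZ.changeOfVariablesRel ∪ Literature.NumberTheory.Transcendental.KZ.newtonLeibnizRel ∪ {c | ∃ (K L : Set (Fin 2 → ℝ)) (r₀ r₁ r₂ : Literature.NumberTheory.Transcendental.KZ.IntegralRep 3) (r₃ : Literature.NumberTheory.Transcendental.KZ.IntegralRep 4), Literature.ModelTheory.ExponentialFields.IsSemialgebraic ℚ K ∧ Literature.ModelTheory.ExponentialFields.IsSemialgebraic ℚ L ∧ Convex ℝ K ∧ Convex ℝ L ∧ IsCompact K ∧ IsCompact L ∧ K.Nonempty ∧ L.Nonempty ∧ r₀.domain = {x : Fin 3 → ℝ | ∃ q ∈ L, (![((1 - x 0 ^ 2) * q 0 - 2 * x 0 * q 1) / (1 + x 0 ^ 2) + x 1, (2 * x 0 * q 0 +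 (1 - x 0 ^ 2) * q 1) / (1 + x 0 ^ 2) + x 2] : Fin 2 → ℝ) ∈ K} ∧ Set.EqOn r₀.integrand (fun x => 2 / (1 + x 0 ^ 2)) r₀.domain ∧ r₁.domain = {x : Fin 3 → ℝ | (![x 1, x 2] : Fin 2 → ℝ) ∈ K} ∧ Set.EqOn r₁.integrand (fun x => 2 / (1 + x 0 ^ 2)) r₁.domain ∧ r₂.domain = {x : Fin 3 → ℝ | (![x 1, x 2] : Fin 2 → ℝ) ∈ L} ∧ Set.EqOn r₂.integrand (fun x => 2 / (1 + x 0 ^ 2)) r₂.domain ∧ r₃.domain = {z : Fin 4 → ℝ | (0 ≤ z 1 ∧ ∃ q ∈ K, (1 - z 0 ^ 2) * q 0 + 2 * z 0 * q 1 = (1 + z 0 ^ 2) * z 1) ∧ (0 ≤ z 3 ∧ ∃ q ∈ L, (1 - z 2 ^ 2) * q 0 + 2 * z 2 * q 1 = (1 + z 2 ^ 2) * z 3)} ∧ Set.EqOn r₃.integrand (fun z => 4 / ((1 + z 0 ^ 2) * (1 + z 2 ^ 2))) r₃.domain ∧ c = Literature.NumberTheory.Transcendental.KZ.of r₀ - Literature.NumberTheory.Transcendental.KZ.of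 r₁ - Literature.NumberTheory.Transcendental.KZ.of r₂ - Literature.NumberTheory.Transcendental.KZ.of r₃}) := by
  intro c hc
  refine hRed _ ?_ ?_ c hc
  · -- (i) `KZ.relations ≤ R_kin`: the four move sets are among the generators of `KZ^kin`
    show AddSubgroup.closure _ ≤ _
    exact AddSubgroup.closure_mono Set.subset_union_left
  · -- (ii) equal-valued one-dimensional pairs: planar layer + landed `AreasToArcs`, then (i)
    intro r r' hv
    have h : KZ.of r - KZ.of r' ∈ AddSubgroup.closure (KZ.domainAddRel ∪ KZ.integrandAddRel ∪
        KZ.changeOfVariablesRel ∪ KZ.newtonLeibnizRel) :=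
      Summit.KontsevichZagierPeriods.AbelContraction.AreasToArcs.areasToArcs_proof hP r r' hv
    exact AddSubgroup.closure_mono Set.subset_union_left h

/-- **The skeleton theorem** (concludes the crux BY NAME; `sorry` enters only through the two named
stubs): `KinematicKernelR` from the 1-PERIOD LAYER and the REDUCTION TO DIMENSION ONE.
[cite: KontsevichZagier2001, §1.2] -/
theorem KinematicKernelR_of :
    Summit.KontsevichZagierPeriods.KontsevichZagierPeriods.Theses.KinematicFormulas.KinematicKernelR :=
  kinematicKernelR_of_stubs stub_planarAreas stub_reductionToDimensionOne

end Summit.KontsevichZagierPeriods.KontsevichZagierPeriods.Cruxes.KinematicKernelR.Birth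

end
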